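import Summits.HodgeConjecture.HodgeConjecture.Theorems.PadicSemiregularLiftFermatAnchorAssemblyEulerCochains

/-!
# The `ℤ`-graded Hom complex of a pair of graded matrix factorizations, IV: bigraded projections (line `witt-lift-rigid-mf`)

Crux `FermatAnchorAssembly` (stmt-HodgeConjecture-14874), stub `stub_eulerBaseChange`; continues
`…EulerCochains.lean`.

The space of ALL pairs of polynomial matrices is the direct sum of its bigraded pieces; this file provides
the projections onto the pieces and their compatibility with the odd differential `hMap`, which is the
tool for separating twists in the finiteness theorem (`Hom(M, N(t)) = 0` for almost all `t`):

* `proj S` — the `A`-linear projection of `A[x₁, …, x_ν]` onto the monomials with exponents in `S`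
  (`coeff_proj`); for `S = homogSet m L d c`: it fixes bihomogeneous polynomials of bidegree `(d, c)`,
  kills those of bidegree `(d', c)` with `d' ≠ d`, its values are bihomogeneous, and it is
  `A[x]`-balanced against bihomogeneous factors: `proj_(d,c) (u · q) = proj_(d−d',c−c') (u) · q` for `q`
  of bidegree `(d', c')` (`proj_mul_of_isBihom`);
* `GMFData.projP t`, `GMFData.projQ t` — the entrywise projections of even / odd pairs onto the cochains
  of twist `t` (`projP_mem`, `projP_eq_self`, `projP_eq_zero_of_ne`, `projQ_mem`);
* `GMFData.hMap_projQ` — `hMap (projQ t w) = projP t (hMap w)` for a lawful pair (the entries of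
  `φ, ψ` are bihomogeneous of the bidegrees that make `hMap` bigraded of degree `0`);
* registered sub-goal `nullSub_eq_of_mem_range`: a cochain of twist `t` that is null-homotopic by an
  ARBITRARY homotopy is null-homotopic by a homotopy of twist `t` (`closedSub t ∩ hMap(everything) = nullSub t`).

All `[folklore]`; no named fact, no `sorry`.
-/

-- `Summit.HodgeConjecture.HodgeConjecture.…` is the tree's mandated summit/problem namespace (single-problem summit).
set_option linter.dupNamespace false

noncomputable section

open Finset
open scoped Classical

namespace Summit.HodgeConjecture.HodgeConjecture.Cruxes.FermatAnchorAssembly.WittLiftRigidMf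

variable {ν m : ℕ} {A : Type} [CommRing A]

/-! ### Projection of a polynomial onto a set of monomials -/

/-- The part of `q` supported on the exponents in `S` (a plain function; see `proj`). [folklore] -/
def projFun (S : Set (Fin ν →₀ ℕ)) (q : MvPolynomial (Fin ν) A) : MvPolynomial (Fin ν) A :=
  AddMonoidAlgebra.ofCoeff ((AddMonoidAlgebra.coeff q).filter (· ∈ S))

/-- Coefficients of `projFun`. [folklore] -/
theorem coeff_projFun (S : Set (Fin ν →₀ ℕ)) (q : MvPolynomial (Fin ν) A) (e : Fin ν →₀ ℕ) :
    (projFun S q).coeff e = if e ∈ S then q.coeff e else 0 := by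
  change ((AddMonoidAlgebra.coeff q).filter (· ∈ S)) e = _
  rw [Finsupp.filter_apply]
  rfl

/-- **The projection `proj S : A[x] → A[x]` onto the monomials with exponents in `S`**, `A`-linear. [folklore] -/
def proj (S : Set (Fin ν →₀ ℕ)) : MvPolynomial (Fin ν) A →ₗ[A] MvPolynomial (Fin ν) A where
  toFun := projFun S
  map_add' p q := by
    apply MvPolynomial.ext
    intro e
    simp only [coeff_projFun, MvPolynomial.coeff_add]
    split_ifs <;> simp
  map_smul' a q := by
    apply MvPolynomial.ext
    intro e
    simp only [coeff_projFun, MvPolynomial.coeff_smul, RingHom.id_apply]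
    split_ifs <;> simp

/-- Coefficients of `proj`: `coeff_e (proj S q) = [e ∈ S] coeff_e q`. [folklore] -/
@[simp] theorem coeff_proj (S : Set (Fin ν →₀ ℕ)) (q : MvPolynomial (Fin ν) A) (e : Fin ν →₀ ℕ) :
    (proj S q).coeff e = if e ∈ S then q.coeff e else 0 :=
  coeff_projFun S q e

/-- The values of `proj (homogSet d c)` are bihomogeneous of bidegree `(d, c)`. [folklore] -/
theorem isBihom_proj (L : AddSubgroup (Fin ν → ZMod m)) (d : ℤ) (c : Fin ν → ZMod m)
    (q : MvPolynomial (Fin ν) A) : IsBihom m L (proj (homogSet m L d c) q) d c := by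
  intro e he
  rw [MvPolynomial.mem_support_iff, coeff_proj] at he
  by_cases h : e ∈ homogSet m L d c
  · exact h
  · exact absurd (if_neg h) he

/-- `proj (homogSet d c)` fixes bihomogeneous polynomials of bidegree `(d, c)`. [folklore] -/
theorem proj_eq_self_of_isBihom {L : AddSubgroup (Fin ν → ZMod m)} {d : ℤ} {c : Fin ν → ZMod m}
    {q : MvPolynomial (Fin ν) A} (h : IsBihom m L q d c) : proj (homogSet m L d c) q = q := by
  apply MvPolynomial.ext
  intro e
  rw [coeff_proj]
  split_ifs with he
  · rfl
  · by_contra hne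
    exact he (h e (MvPolynomial.mem_support_iff.mpr (Ne.symm hne)))

/-- `proj (homogSet d c)` kills bihomogeneous polynomials of bidegree `(d', c')` with `d' ≠ d`. [folklore] -/
theorem proj_eq_zero_of_isBihom_of_ne {L : AddSubgroup (Fin ν → ZMod m)} {d d' : ℤ}
    {c c' : Fin ν → ZMod m} {q : MvPolynomial (Fin ν) A} (h : IsBihom m L q d' c') (hd : d' ≠ d) :
    proj (homogSet m L d c) q = 0 := by
  apply MvPolynomial.ext
  intro e
  rw [coeff_proj, MvPolynomial.coeff_zero]
  split_ifs with he
  · by_contra hne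
    exact hd ((h e (MvPolynomial.mem_support_iff.mpr hne)).1.symm.trans he.1)
  · rfl

/-- **`proj` is balanced against bihomogeneous right factors**: for `q` of bidegree `(d', c')` and
`d₁ + d' = d`, `c₁ + c' = c`, `proj_(d,c) (u · q) = proj_(d₁,c₁) (u) · q`. [folklore] -/
theorem proj_mul_of_isBihom {L : AddSubgroup (Fin ν → ZMod m)} {d d' d₁ : ℤ} {c c' c₁ : Fin ν → ZMod m}
    {q : MvPolynomial (Fin ν) A} (h : IsBihom m L q d' c') (hd : d₁ + d' = d) (hc : c₁ + c' = c)
    (u : MvPolynomial (Fin ν) A) :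
    proj (homogSet m L d c) (u * q) = proj (homogSet m L d₁ c₁) u * q := by
  have hd₁ : d₁ = d - d' := by omega
  have hc₁ : c₁ = c - c' := by rw [← hc]; abel
  apply MvPolynomial.ext
  intro e
  rw [coeff_proj, MvPolynomial.coeff_mul, MvPolynomial.coeff_mul]
  -- termwise comparison over the antidiagonal of `e`
  have key : ∀ x ∈ Finset.antidiagonal e,
      (if e ∈ homogSet m L d c then u.coeff x.1 * q.coeff x.2 else 0) =
        (proj (homogSet m L d₁ c₁) u).coeff x.1 * q.coeff x.2 := by
    intro x hx
    rw [Finset.mem_antidiagonal] at hx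
    rw [coeff_proj]
    by_cases hq : q.coeff x.2 = 0
    · simp [hq]
    · have hx2 : x.2 ∈ homogSet m L d' c' := h x.2 (MvPolynomial.mem_support_iff.mpr hq)
      have hiff : e ∈ homogSet m L d c ↔ x.1 ∈ homogSet m L d₁ c₁ := by
        rw [← hx, add_mem_homogSet_iff hx2, hd₁, hc₁]
      by_cases he : e ∈ homogSet m L d c
      · rw [if_pos he, if_pos (hiff.mp he)]
      · rw [if_neg he, if_neg (fun h' ↦ he (hiff.mpr h')), zero_mul]
  rw [← Finset.sum_congr rfl key]
  split_ifs <;> simp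

/-- The symmetric statement for bihomogeneous LEFT factors: `proj_(d,c) (q · u) = q · proj_(d₁,c₁) (u)`. [folklore] -/
theorem proj_mul_of_isBihom_left {L : AddSubgroup (Fin ν → ZMod m)} {d d' d₁ : ℤ}
    {c c' c₁ : Fin ν → ZMod m} {q : MvPolynomial (Fin ν) A} (h : IsBihom m L q d' c')
    (hd : d' + d₁ = d) (hc : c' + c₁ = c) (u : MvPolynomial (Fin ν) A) :
    proj (homogSet m L d c) (q * u) = q * proj (homogSet m L d₁ c₁) u := by
  rw [mul_comm, proj_mul_of_isBihom (d := d) (d₁ := d₁) (c := c) (c₁ := c₁) h (by omega)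
    (by rw [← hc]; abel) u, mul_comm]

/-! ### Entrywise projections of pairs of matrices onto cochains of twist `t` -/

namespace GMFData

variable {ι₀ ι₁ κ₀ κ₁ : Type}

/-- The projection of an even pair `(a, b)` onto the even cochains of twist `t` (entrywise `proj`). [folklore] -/
def projP (L : AddSubgroup (Fin ν → ZMod m)) (t : ℤ) (M : GMFData A ν m ι₀ ι₁) (N : GMFData A ν m κ₀ κ₁) :
    (Matrix κ₀ ι₀ (MvPolynomial (Fin ν) A) × Matrix κ₁ ι₁ (MvPolynomial (Fin ν) A)) →ₗ[A]
      (Matrix κ₀ ι₀ (MvPolynomial (Fin ν) A) × Matrix κ₁ ι₁ (MvPolynomial (Fin ν) A)) where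
  toFun z := (Matrix.of fun k i ↦ proj (homogSet m L (M.d₀ i - N.d₀ k + t) (M.c₀ i - N.c₀ k)) (z.1 k i),
    Matrix.of fun l j ↦ proj (homogSet m L (M.d₁ j - N.d₁ l + t) (M.c₁ j - N.c₁ l)) (z.2 l j))
  map_add' z z' := by
    ext <;> simp [Matrix.add_apply, map_add]
  map_smul' a z := by
    ext <;> simp [Matrix.smul_apply, map_smul]

/-- The projection of an odd pair `(s, u)` onto the odd cochains of twist `t` (entrywise `proj`). [folklore] -/
def projQ (L : AddSubgroup (Fin ν → ZMod m)) (t : ℤ) (M : GMFData A ν m ι₀ ι₁) (N : GMFData A ν m κ₀ κ₁) :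
    (Matrix κ₁ ι₀ (MvPolynomial (Fin ν) A) × Matrix κ₀ ι₁ (MvPolynomial (Fin ν) A)) →ₗ[A]
      (Matrix κ₁ ι₀ (MvPolynomial (Fin ν) A) × Matrix κ₀ ι₁ (MvPolynomial (Fin ν) A)) where
  toFun w := (Matrix.of fun l i ↦ proj (homogSet m L (M.d₀ i - N.d₁ l + t) (M.c₀ i - N.c₁ l)) (w.1 l i),
    Matrix.of fun k j ↦ proj (homogSet m L (M.d₁ j - m - N.d₀ k + t) (M.c₁ j - N.c₀ k)) (w.2 k j))
  map_add' w w' := by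
    ext <;> simp [Matrix.add_apply, map_add]
  map_smul' a w := by
    ext <;> simp [Matrix.smul_apply, map_smul]

/-- Entries of `projP`. [folklore] -/
theorem projP_apply_fst (L : AddSubgroup (Fin ν → ZMod m)) (t : ℤ) (M : GMFData A ν m ι₀ ι₁)
    (N : GMFData A ν m κ₀ κ₁)
    (z : Matrix κ₀ ι₀ (MvPolynomial (Fin ν) A) × Matrix κ₁ ι₁ (MvPolynomial (Fin ν) A)) (k : κ₀) (i : ι₀) :
    (projP L t M N z).1 k i = proj (homogSet m L (M.d₀ i - N.d₀ k + t) (M.c₀ i - N.c₀ k)) (z.1 k i) := rfl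

/-- Entries of `projP`. [folklore] -/
theorem projP_apply_snd (L : AddSubgroup (Fin ν → ZMod m)) (t : ℤ) (M : GMFData A ν m ι₀ ι₁)
    (N : GMFData A ν m κ₀ κ₁)
    (z : Matrix κ₀ ι₀ (MvPolynomial (Fin ν) A) × Matrix κ₁ ι₁ (MvPolynomial (Fin ν) A)) (l : κ₁) (j : ι₁) :
    (projP L t M N z).2 l j = proj (homogSet m L (M.d₁ j - N.d₁ l + t) (M.c₁ j - N.c₁ l)) (z.2 l j) := rfl

/-- Entries of `projQ`. [folklore] -/
theorem projQ_apply_fst (L : AddSubgroup (Fin ν → ZMod m)) (t : ℤ) (M : GMFData A ν m ι₀ ι₁)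
    (N : GMFData A ν m κ₀ κ₁)
    (w : Matrix κ₁ ι₀ (MvPolynomial (Fin ν) A) × Matrix κ₀ ι₁ (MvPolynomial (Fin ν) A)) (l : κ₁) (i : ι₀) :
    (projQ L t M N w).1 l i = proj (homogSet m L (M.d₀ i - N.d₁ l + t) (M.c₀ i - N.c₁ l)) (w.1 l i) := rfl

/-- Entries of `projQ`. [folklore] -/
theorem projQ_apply_snd (L : AddSubgroup (Fin ν → ZMod m)) (t : ℤ) (M : GMFData A ν m ι₀ ι₁)
    (N : GMFData A ν m κ₀ κ₁)
    (w : Matrix κ₁ ι₀ (MvPolynomial (Fin ν) A) × Matrix κ₀ ι₁ (MvPolynomial (Fin ν) A)) (k : κ₀) (j : ι₁) :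
    (projQ L t M N w).2 k j = proj (homogSet m L (M.d₁ j - m - N.d₀ k + t) (M.c₁ j - N.c₀ k)) (w.2 k j) :=
  rfl

/-- `projP t` lands in the even cochains of twist `t`. [folklore] -/
theorem projP_mem (L : AddSubgroup (Fin ν → ZMod m)) (t : ℤ) (M : GMFData A ν m ι₀ ι₁)
    (N : GMFData A ν m κ₀ κ₁)
    (z : Matrix κ₀ ι₀ (MvPolynomial (Fin ν) A) × Matrix κ₁ ι₁ (MvPolynomial (Fin ν) A)) :
    projP L t M N z ∈ cochainSub L t M N :=
  ⟨fun _ _ ↦ isBihom_proj L _ _ _, fun _ _ ↦ isBihom_proj L _ _ _⟩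

/-- `projQ t` lands in the odd cochains of twist `t`. [folklore] -/
theorem projQ_mem (L : AddSubgroup (Fin ν → ZMod m)) (t : ℤ) (M : GMFData A ν m ι₀ ι₁)
    (N : GMFData A ν m κ₀ κ₁)
    (w : Matrix κ₁ ι₀ (MvPolynomial (Fin ν) A) × Matrix κ₀ ι₁ (MvPolynomial (Fin ν) A)) :
    projQ L t M N w ∈ oddSub L t M N :=
  ⟨fun _ _ ↦ isBihom_proj L _ _ _, fun _ _ ↦ isBihom_proj L _ _ _⟩

/-- `projP t` fixes even cochains of twist `t`. [folklore] -/
theorem projP_eq_self {L : AddSubgroup (Fin ν → ZMod m)} {t : ℤ} {M : GMFData A ν m ι₀ ι₁}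
    {N : GMFData A ν m κ₀ κ₁}
    {z : Matrix κ₀ ι₀ (MvPolynomial (Fin ν) A) × Matrix κ₁ ι₁ (MvPolynomial (Fin ν) A)}
    (hz : z ∈ cochainSub L t M N) : projP L t M N z = z := by
  obtain ⟨ha, hb⟩ := hz
  refine Prod.ext (Matrix.ext fun k i ↦ ?_) (Matrix.ext fun l j ↦ ?_)
  · rw [projP_apply_fst, proj_eq_self_of_isBihom (ha k i)]
  · rw [projP_apply_snd, proj_eq_self_of_isBihom (hb l j)]

/-- `projP t` kills even cochains of twist `t' ≠ t`. [folklore] -/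
theorem projP_eq_zero_of_ne {L : AddSubgroup (Fin ν → ZMod m)} {t t' : ℤ} {M : GMFData A ν m ι₀ ι₁}
    {N : GMFData A ν m κ₀ κ₁}
    {z : Matrix κ₀ ι₀ (MvPolynomial (Fin ν) A) × Matrix κ₁ ι₁ (MvPolynomial (Fin ν) A)}
    (hz : z ∈ cochainSub L t' M N) (ht : t' ≠ t) : projP L t M N z = 0 := by
  obtain ⟨ha, hb⟩ := hz
  refine Prod.ext (Matrix.ext fun k i ↦ ?_) (Matrix.ext fun l j ↦ ?_)
  · rw [projP_apply_fst, proj_eq_zero_of_isBihom_of_ne (ha k i) (by omega)]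
    rfl
  · rw [projP_apply_snd, proj_eq_zero_of_isBihom_of_ne (hb l j) (by omega)]
    rfl

variable [Fintype ι₀] [Fintype ι₁] [Fintype κ₀] [Fintype κ₁] [DecidableEq ι₀] [DecidableEq ι₁]
  [DecidableEq κ₀] [DecidableEq κ₁]

/-- **`hMap` is bigraded of degree `0`**: `hMap (projQ t w) = projP t (hMap w)` for a lawful pair (only
the bihomogeneity of the entries of `φ_M, ψ_M, φ_N, ψ_N` is used). [folklore] -/
theorem hMap_projQ {L : AddSubgroup (Fin ν → ZMod m)} (M : GMF A ν m L ι₀ ι₁) (N : GMF A ν m L κ₀ κ₁)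
    (t : ℤ) (w : Matrix κ₁ ι₀ (MvPolynomial (Fin ν) A) × Matrix κ₀ ι₁ (MvPolynomial (Fin ν) A)) :
    hMap M.toGMFData N.toGMFData (projQ L t M.toGMFData N.toGMFData w) =
      projP L t M.toGMFData N.toGMFData (hMap M.toGMFData N.toGMFData w) := by
  obtain ⟨s, u⟩ := w
  refine Prod.ext (Matrix.ext fun k i ↦ ?_) (Matrix.ext fun l j ↦ ?_)
  · rw [projP_apply_fst, hMap_apply, hMap_apply]
    change ((projQ L t M.toGMFData N.toGMFData (s, u)).2 * M.ψ +
        N.φ * (projQ L t M.toGMFData N.toGMFData (s, u)).1) k i =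
      proj (homogSet m L (M.d₀ i - N.d₀ k + t) (M.c₀ i - N.c₀ k)) ((u * M.ψ + N.φ * s) k i)
    rw [Matrix.add_apply, Matrix.mul_apply, Matrix.mul_apply, Matrix.add_apply, Matrix.mul_apply,
      Matrix.mul_apply, map_add, map_sum, map_sum]
    congr 1
    · refine Finset.sum_congr rfl fun j _ ↦ ?_
      rw [projQ_apply_snd]
      exact (proj_mul_of_isBihom (d := M.d₀ i - N.d₀ k + t) (c := M.c₀ i - N.c₀ k)
        (M.ψ_bihom j i) (by ring) (by abel) (u k j)).symm
    · refine Finset.sum_congr rfl fun l _ ↦ ?_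
      rw [projQ_apply_fst]
      exact (proj_mul_of_isBihom_left (d := M.d₀ i - N.d₀ k + t) (c := M.c₀ i - N.c₀ k)
        (N.φ_bihom k l) (by ring) (by abel) (s l i)).symm
  · rw [projP_apply_snd, hMap_apply, hMap_apply]
    change ((projQ L t M.toGMFData N.toGMFData (s, u)).1 * M.φ +
        N.ψ * (projQ L t M.toGMFData N.toGMFData (s, u)).2) l j =
      proj (homogSet m L (M.d₁ j - N.d₁ l + t) (M.c₁ j - N.c₁ l)) ((s * M.φ + N.ψ * u) l j)
    rw [Matrix.add_apply, Matrix.mul_apply, Matrix.mul_apply, Matrix.add_apply, Matrix.mul_apply,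
      Matrix.mul_apply, map_add, map_sum, map_sum]
    congr 1
    · refine Finset.sum_congr rfl fun i _ ↦ ?_
      rw [projQ_apply_fst]
      exact (proj_mul_of_isBihom (d := M.d₁ j - N.d₁ l + t) (c := M.c₁ j - N.c₁ l)
        (M.φ_bihom i j) (by ring) (by abel) (s l i)).symm
    · refine Finset.sum_congr rfl fun k _ ↦ ?_
      rw [projQ_apply_snd]
      exact (proj_mul_of_isBihom_left (d := M.d₁ j - N.d₁ l + t) (c := M.c₁ j - N.c₁ l)
        (N.ψ_bihom l k) (by ring) (by abel) (u k j)).symm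

/-- **A closed-or-not cochain of twist `t` lying in the image of `hMap` on ALL odd pairs already lies in
`nullSub t`** (project the homotopy onto twist `t`). [folklore] -/
theorem mem_nullSub_of_mem_range {L : AddSubgroup (Fin ν → ZMod m)} (M : GMF A ν m L ι₀ ι₁)
    (N : GMF A ν m L κ₀ κ₁) (t : ℤ)
    {z : Matrix κ₀ ι₀ (MvPolynomial (Fin ν) A) × Matrix κ₁ ι₁ (MvPolynomial (Fin ν) A)}
    (hz : z ∈ cochainSub L t M.toGMFData N.toGMFData)
    (hr : z ∈ LinearMap.range (hMap M.toGMFData N.toGMFData)) :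
    z ∈ nullSub L t M.toGMFData N.toGMFData := by
  obtain ⟨w, rfl⟩ := hr
  rw [mem_nullSub]
  refine ⟨projQ L t M.toGMFData N.toGMFData w, projQ_mem L t _ _ w, ?_⟩
  rw [hMap_projQ, projP_eq_self hz]

end GMFData

/-- **Registered sub-goal: homotopies can be taken bihomogeneous.** For a lawful pair, an even cochain of
twist `t` that is `hMap` of an arbitrary odd pair is `hMap` of an odd cochain of twist `t`. [folklore] -/
theorem nullSet_eq_cochainSet_inter_range : ∀ (A : Type) [CommRing A] (ν m : ℕ)
    (L : AddSubgroup (Fin ν → ZMod m)) (ι₀ ι₁ κ₀ κ₁ : Type) [Fintype ι₀] [Fintype ι₁] [Fintype κ₀]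
    [Fintype κ₁] [DecidableEq ι₀] [DecidableEq ι₁] [DecidableEq κ₀] [DecidableEq κ₁]
    (M : GMF A ν m L ι₀ ι₁) (N : GMF A ν m L κ₀ κ₁) (t : ℤ),
    GMFData.nullSet m L t M.toGMFData N.toGMFData =
      GMFData.cochainSet m L t M.toGMFData N.toGMFData ∩
        Set.range (GMFData.hMap M.toGMFData N.toGMFData) := by
  intro A _ ν m L ι₀ ι₁ κ₀ κ₁ _ _ _ _ _ _ _ _ M N t
  ext z
  constructor
  · intro hz
    rw [← GMFData.coe_nullSub, SetLike.mem_coe, GMFData.mem_nullSub] at hz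
    obtain ⟨su, hsu, rfl⟩ := hz
    exact ⟨GMFData.hMap_mem_cochainSet M N t hsu, su, rfl⟩
  · rintro ⟨hz, w, rfl⟩
    rw [← GMFData.coe_nullSub, SetLike.mem_coe]
    exact GMFData.mem_nullSub_of_mem_range M N t hz (LinearMap.mem_range_self _ w)

end Summit.HodgeConjecture.HodgeConjecture.Cruxes.FermatAnchorAssembly.WittLiftRigidMf

end
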